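import Summits.Parity.GeneralizedHardyLittlewood.Theses.LiouvilleShiftedTables
import Summits.Parity.GeneralizedHardyLittlewood.Theorems.TableChowla.Negative.TableChowlaFalseWithoutShiftNeZero

/-!
# `TableChowla` (stmt-Parity-14270): the window hypotheses are load-bearing — degenerate tables

Negative lemmas for the crux `LiouvilleShiftedTables.TableChowla` (cdisprove seat), continuing
`TableChowlaFalseWithoutShiftNeZero`. With `TableChowlaFor f` the crux shape for a general
`f : ℕ → ℝ` (`tableChowla_iff : TableChowla ↔ TableChowlaFor λ` by `Iff.rfl`) and `TableChowlaAt f δ`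
its fixed-`δ` slice:
* ONE-ROW table (`A = 1`, rows `{2}`, `⌊x⌋` columns, `T = ⌊x⌋²`): the lower window bound `x^δ ≤ A`
  and `0 < δ` are load-bearing (`not_tableChowlaWithoutLowerWindow`, `not_tableChowlaWithoutDeltaPos`);
* ONE-COLUMN table (`A = x`, `B = 1`, `T = N²`): the upper window bound and `δ ≤ 1/12` are
  load-bearing (`not_tableChowlaWithoutUpperWindow`, `not_tableChowlaWithoutDeltaLe` — the latter is
  the shape of the refuted gen-1 crux stmt-Parity-4218), sharpened to the
  DEGENERATE BAND `2/3 ≤ δ ≤ 1` where the slice is false for EVERY `±1`-valued `f`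
  (`not_tableChowlaAt_of_mem_band`) against the VACUOUS BAND `δ > 1` where it holds for every `f`
  (`tableChowlaAt_of_one_lt`);
* `0 < C` is NOT load-bearing (`tableChowlaWithoutCPos_of`). [folklore]
-/

namespace Summit.Parity.GeneralizedHardyLittlewood.Theorems.TableChowla.Negative

open Finset Real ArithmeticFunction
open Summit.Parity.GeneralizedHardyLittlewood.Theses

noncomputable section

/-- The crux with `λ` replaced by an arbitrary `f : ℕ → ℝ`. -/
def TableChowlaFor (f : ℕ → ℝ) : Prop :=
  ∀ c : ℤ, c ≠ 0 → ∀ δ : ℝ, 0 < δ → δ ≤ 1 / 12 → ∀ C : ℝ, 0 < C → ∃ x₀ : ℝ, ∀ x : ℝ, x₀ ≤ x →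
    ∀ A : ℝ, x ^ δ ≤ A → A ≤ x ^ (1 / 3 + δ) → moment f c x A ≤ x ^ 2 / Real.log x ^ C

/-- READ-BACK: the crux is literally `TableChowlaFor λ`. -/
theorem tableChowla_iff : LiouvilleShiftedTables.TableChowla ↔ TableChowlaFor lam := Iff.rfl

variable {f : ℕ → ℝ} {c : ℤ} {A₁ A₂ B : ℕ}

/-- The moment is a sum of squares. -/
theorem momentN_nonneg : 0 ≤ momentN f c A₁ A₂ B :=
  sum_nonneg fun _ _ => sum_nonneg fun _ _ => sq_nonneg _

/-- The row-diagonal is a lower bound for the moment. -/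
theorem diag_le_momentN : ∑ a ∈ Ioc A₁ A₂, rowCorr f c B a a ^ 2 ≤ momentN f c A₁ A₂ B := by
  unfold momentN
  refine sum_le_sum fun a ha => ?_
  exact single_le_sum (f := fun a' => rowCorr f c B a a' ^ 2) (fun _ _ => sq_nonneg _) ha

/-- A diagonal row correlation of a table with `±1` entries equals the row length. -/
theorem rowCorr_self_eq {a : ℕ} (hf : ∀ n, n ≠ 0 → f n ^ 2 = 1)
    (hpos : ∀ b ∈ Icc 1 B, 1 ≤ (a : ℤ) * b + c) : rowCorr f c B a a = B := by
  unfold rowCorr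
  calc ∑ b ∈ Icc 1 B, f (Int.toNat ((a : ℤ) * b + c)) * f (Int.toNat ((a : ℤ) * b + c))
        = ∑ b ∈ Icc 1 B, (1 : ℝ) := by
          refine sum_congr rfl fun b hb => ?_
          rw [← sq]
          apply hf
          intro h0
          rw [Int.toNat_eq_zero] at h0
          linarith [hpos b hb]
    _ = B := by simp

/-- One-column tables: `S_f(a,a') = f(a+c) f(a'+c)`. -/
theorem rowCorr_one_col (a a' : ℕ) :
    rowCorr f c 1 a a' = f (Int.toNat ((a : ℤ) + c)) * f (Int.toNat ((a' : ℤ) + c)) := by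
  simp [rowCorr]

/-- Zero-column tables have zero moment. -/
theorem momentN_zero_cols : momentN f c A₁ A₂ 0 = 0 := by
  simp [momentN, rowCorr]

/-- Junk value `λ 0 = 0`. -/
theorem lam_zero : lam 0 = 0 := by simp [lam]

/-- `λ(n)² = 1` for `n ≥ 1` (explicit-argument form). -/
theorem lam_sq' : ∀ n : ℕ, n ≠ 0 → lam n ^ 2 = 1 := fun _ hn => lam_sq hn

/-- `λ(n)² ≤ 1` for all `n` (including the junk value at `0`). -/
theorem lam_sq_le_one (n : ℕ) : lam n ^ 2 ≤ 1 := by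
  rcases eq_or_ne n 0 with rfl | hn
  · simp [lam_zero]
  · rw [lam_sq hn]

/-- `|λ(n)| ≤ 1`. -/
theorem abs_lam_le_one (n : ℕ) : |lam n| ≤ 1 := by
  have h := lam_sq_le_one n
  rw [abs_le]
  constructor <;> nlinarith [sq_nonneg (lam n - 1), sq_nonneg (lam n + 1)]

/-- `log 3 > 1`. -/
theorem one_lt_log_three : (1 : ℝ) < Real.log 3 := by
  rw [Real.lt_log_iff_exp_lt (by norm_num)]
  have := Real.exp_one_lt_d9; linarith

/-- One-row table: at `A = 1` the rows are `Ioc 1 2 = {2}` and there are `⌊x⌋` columns. -/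
theorem moment_one_row (f : ℕ → ℝ) (c : ℤ) (x : ℝ) :
    moment f c x 1 = rowCorr f c ⌊x⌋₊ 2 2 ^ 2 := by
  unfold moment momentN
  have h12 : (Ioc 1 2 : Finset ℕ) = {2} := by decide
  rw [Nat.floor_one, show (2 * (1 : ℝ)) = ((2 : ℕ) : ℝ) by norm_num, Nat.floor_natCast, div_one, h12]
  simp

/-- One-column table: at `A = x = N` the columns are `Icc 1 1`, the rows `(N, 2N]`, and for a
`±1`-valued `f` and `c ≥ 0` every summand is `1`: the moment is `N²`. -/
theorem moment_one_col {N : ℕ} (hN : N ≠ 0) (hf : ∀ n, n ≠ 0 → f n ^ 2 = 1) (hc : 0 ≤ c) :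
    moment f c N N = (N : ℝ) ^ 2 := by
  unfold moment momentN
  rw [Nat.floor_natCast, floor_two_mul_natCast, div_self (by exact_mod_cast hN : (N : ℝ) ≠ 0),
    Nat.floor_one]
  have hterm : ∀ a ∈ Ioc N (2 * N), ∀ a' ∈ Ioc N (2 * N), rowCorr f c 1 a a' ^ 2 = 1 := by
    intro a ha a' ha'
    simp only [mem_Ioc] at ha ha'
    rw [rowCorr_one_col, mul_pow, hf, hf, one_mul]
    · intro h0; rw [Int.toNat_eq_zero] at h0; omega
    · intro h0; rw [Int.toNat_eq_zero] at h0; omega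
  rw [sum_congr rfl fun a ha => sum_congr rfl fun a' ha' => hterm a ha a' ha']
  simp only [sum_const, Nat.card_Ioc, nsmul_eq_mul, mul_one, show 2 * N - N = N by omega]
  ring

/-- The one-row table at `A = 1`, `c = 1`, `x = N ≥ 3` violates the bound with `C = 1`. -/
theorem one_row_violates {N : ℕ} (hN3 : (3 : ℝ) ≤ N) :
    ¬ (moment lam 1 N 1 ≤ (N : ℝ) ^ 2 / Real.log N ^ (1 : ℝ)) := by
  intro key
  rw [moment_one_row, Nat.floor_natCast, rowCorr_self_eq lam_sq' (fun b _ => by push_cast; omega),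
    Real.rpow_one] at key
  have hlog : 1 < Real.log N := one_lt_log_three.trans_le (Real.log_le_log (by norm_num) hN3)
  have hNpos : (0 : ℝ) < N := by linarith
  exact absurd_of_le_div (by positivity) (le_of_eq (one_mul _).symm) zero_le_one hlog key

/-- The one-column table at `A = x = N ≥ 3`, `c = 1` violates the bound with `C = 1`, for every
`±1`-valued `f`. -/
theorem one_col_violates (hf : ∀ n, n ≠ 0 → f n ^ 2 = 1) {N : ℕ} (hN3 : (3 : ℝ) ≤ N) :
    ¬ (moment f 1 N N ≤ (N : ℝ) ^ 2 / Real.log N ^ (1 : ℝ)) := by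
  intro key
  have hN0 : N ≠ 0 := by rintro rfl; norm_num at hN3
  rw [moment_one_col hN0 hf zero_le_one, Real.rpow_one] at key
  have hlog : 1 < Real.log N := one_lt_log_three.trans_le (Real.log_le_log (by norm_num) hN3)
  have hNpos : (0 : ℝ) < N := by linarith
  exact absurd_of_le_div (by positivity) (le_of_eq (one_mul _).symm) zero_le_one hlog key

/-- The crux with the lower window bound `x ^ δ ≤ A` weakened to `1 ≤ A`. -/
def TableChowlaWithoutLowerWindow : Prop :=
  ∀ c : ℤ, c ≠ 0 → ∀ δ : ℝ, 0 < δ → δ ≤ 1 / 12 → ∀ C : ℝ, 0 < C → ∃ x₀ : ℝ, ∀ x : ℝ, x₀ ≤ x →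
    ∀ A : ℝ, 1 ≤ A → A ≤ x ^ (1 / 3 + δ) → moment lam c x A ≤ x ^ 2 / Real.log x ^ C

/-- The lower window bound is load-bearing: the ONE-ROW table `A = 1` has moment `⌊x⌋²`. -/
theorem not_tableChowlaWithoutLowerWindow : ¬ TableChowlaWithoutLowerWindow := by
  intro h
  obtain ⟨x₀, hx₀⟩ := h 1 one_ne_zero (1 / 12) (by norm_num) le_rfl 1 one_pos
  obtain ⟨N, hN⟩ := exists_nat_ge (max x₀ 3)
  have hN3 : (3 : ℝ) ≤ N := le_trans (le_max_right _ _) hN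
  have hNx : x₀ ≤ N := le_trans (le_max_left _ _) hN
  have hN1 : (1 : ℝ) ≤ N := by linarith
  exact one_row_violates hN3 (hx₀ N hNx 1 le_rfl (Real.one_le_rpow hN1 (by norm_num)))

/-- The crux with `0 < δ` weakened to `0 ≤ δ`. -/
def TableChowlaWithoutDeltaPos : Prop :=
  ∀ c : ℤ, c ≠ 0 → ∀ δ : ℝ, 0 ≤ δ → δ ≤ 1 / 12 → ∀ C : ℝ, 0 < C → ∃ x₀ : ℝ, ∀ x : ℝ, x₀ ≤ x →
    ∀ A : ℝ, x ^ δ ≤ A → A ≤ x ^ (1 / 3 + δ) → moment lam c x A ≤ x ^ 2 / Real.log x ^ C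

/-- `0 < δ` is load-bearing: `δ = 0` admits the one-row table `A = 1 = x⁰`. -/
theorem not_tableChowlaWithoutDeltaPos : ¬ TableChowlaWithoutDeltaPos := by
  intro h
  obtain ⟨x₀, hx₀⟩ := h 1 one_ne_zero 0 le_rfl (by norm_num) 1 one_pos
  obtain ⟨N, hN⟩ := exists_nat_ge (max x₀ 3)
  have hN3 : (3 : ℝ) ≤ N := le_trans (le_max_right _ _) hN
  have hNx : x₀ ≤ N := le_trans (le_max_left _ _) hN
  have hN1 : (1 : ℝ) ≤ N := by linarith
  refine one_row_violates hN3 (hx₀ N hNx 1 (by rw [Real.rpow_zero]) ?_)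
  rw [add_zero]; exact Real.one_le_rpow hN1 (by norm_num)

/-- The crux with the upper window bound `A ≤ x ^ (1/3 + δ)` dropped. -/
def TableChowlaWithoutUpperWindow : Prop :=
  ∀ c : ℤ, c ≠ 0 → ∀ δ : ℝ, 0 < δ → δ ≤ 1 / 12 → ∀ C : ℝ, 0 < C → ∃ x₀ : ℝ, ∀ x : ℝ, x₀ ≤ x →
    ∀ A : ℝ, x ^ δ ≤ A → moment lam c x A ≤ x ^ 2 / Real.log x ^ C

/-- The upper window bound is load-bearing: the ONE-COLUMN table `A = x` has moment `N²`. -/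
theorem not_tableChowlaWithoutUpperWindow : ¬ TableChowlaWithoutUpperWindow := by
  intro h
  obtain ⟨x₀, hx₀⟩ := h 1 one_ne_zero (1 / 12) (by norm_num) le_rfl 1 one_pos
  obtain ⟨N, hN⟩ := exists_nat_ge (max x₀ 3)
  have hN3 : (3 : ℝ) ≤ N := le_trans (le_max_right _ _) hN
  have hNx : x₀ ≤ N := le_trans (le_max_left _ _) hN
  have hN1 : (1 : ℝ) ≤ N := by linarith
  have hwin : (N : ℝ) ^ ((1 : ℝ) / 12) ≤ N := by
    calc (N : ℝ) ^ ((1 : ℝ) / 12) ≤ (N : ℝ) ^ (1 : ℝ) :=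
          Real.rpow_le_rpow_of_exponent_le hN1 (by norm_num)
      _ = N := Real.rpow_one _
  exact one_col_violates lam_sq' hN3 (hx₀ N hNx N hwin)

/-- The crux at ONE window exponent `δ`, for a general `f` (the constraint `0 < δ ≤ 1/12` removed;
`c ≠ 0` and `∀ C` kept). `TableChowlaFor f ↔ ∀ δ ∈ (0, 1/12], TableChowlaAt f δ`. -/
def TableChowlaAt (f : ℕ → ℝ) (δ : ℝ) : Prop :=
  ∀ c : ℤ, c ≠ 0 → ∀ C : ℝ, 0 < C → ∃ x₀ : ℝ, ∀ x : ℝ, x₀ ≤ x →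
    ∀ A : ℝ, x ^ δ ≤ A → A ≤ x ^ (1 / 3 + δ) → moment f c x A ≤ x ^ 2 / Real.log x ^ C

/-- Quantifier shuffle: `TableChowlaFor f` is the conjunction of the fixed-`δ` statements. -/
theorem tableChowlaFor_iff_forall_at :
    TableChowlaFor f ↔ ∀ δ : ℝ, 0 < δ → δ ≤ 1 / 12 → TableChowlaAt f δ :=
  ⟨fun h δ hδ hδ' c hc C hC => h c hc δ hδ hδ' C hC, fun h c hc δ hδ hδ' C hC => h δ hδ hδ' c hc C hC⟩

/-- The gen-1 crux stmt-Parity-4218 (`ShiftedMultiplicationTable.RectangleChowla`, refuted in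
`Theorems/ShiftedMultiplicationTableRectangleChowlaRefutation.lean`): every `δ > 0` allowed. -/
def TableChowlaWithoutDeltaLe : Prop :=
  ∀ c : ℤ, c ≠ 0 → ∀ δ : ℝ, 0 < δ → ∀ C : ℝ, 0 < C → ∃ x₀ : ℝ, ∀ x : ℝ, x₀ ≤ x →
    ∀ A : ℝ, x ^ δ ≤ A → A ≤ x ^ (1 / 3 + δ) → moment lam c x A ≤ x ^ 2 / Real.log x ^ C

/-- DEGENERATE BAND `δ ∈ [2/3, 1]`: `A = x` is admissible (`x ≤ x^{1/3+δ}` iff `δ ≥ 2/3`,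
`x^δ ≤ x` iff `δ ≤ 1`), the table has ONE column and no cancellation is possible: the fixed-`δ`
statement is FALSE for every `±1`-valued `f`, in particular for `λ`. This is the exact extent of the
gen-1 hole; `δ ≤ 1/12` (indeed any `δ < 2/3`) closes it, since then `B = ⌊x/A⌋ ≥ x^{2/3-δ} → ∞`. -/
theorem not_tableChowlaAt_of_mem_band (hf : ∀ n, n ≠ 0 → f n ^ 2 = 1) {δ : ℝ} (h1 : 2 / 3 ≤ δ)
    (h2 : δ ≤ 1) : ¬ TableChowlaAt f δ := by
  intro h
  obtain ⟨x₀, hx₀⟩ := h 1 one_ne_zero 1 one_pos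
  obtain ⟨N, hN⟩ := exists_nat_ge (max x₀ 3)
  have hN3 : (3 : ℝ) ≤ N := le_trans (le_max_right _ _) hN
  have hNx : x₀ ≤ N := le_trans (le_max_left _ _) hN
  have hN1 : (1 : ℝ) ≤ N := by linarith
  have hwin1 : (N : ℝ) ^ δ ≤ N := by
    calc (N : ℝ) ^ δ ≤ (N : ℝ) ^ (1 : ℝ) := Real.rpow_le_rpow_of_exponent_le hN1 h2
      _ = N := Real.rpow_one _
  have hwin2 : (N : ℝ) ≤ (N : ℝ) ^ (1 / 3 + δ) := by
    calc (N : ℝ) = (N : ℝ) ^ (1 : ℝ) := (Real.rpow_one _).symm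
      _ ≤ (N : ℝ) ^ (1 / 3 + δ) := Real.rpow_le_rpow_of_exponent_le hN1 (by linarith)
  exact one_col_violates hf hN3 (hx₀ N hNx N hwin1 hwin2)

/-- JUNK BAND `δ > 1`: the window forces `A ≥ x^δ > x`, so there are NO columns and the fixed-`δ`
statement holds vacuously for every `f` (a reminder that only `δ < 2/3` carries content). -/
theorem tableChowlaAt_of_one_lt (f : ℕ → ℝ) {δ : ℝ} (hδ : 1 < δ) : TableChowlaAt f δ := by
  intro c _ C _
  refine ⟨2, fun x hx A hA _ => ?_⟩
  have hx1 : (1 : ℝ) < x := by linarith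
  have hxA : x < A := by
    calc x = x ^ (1 : ℝ) := (Real.rpow_one x).symm
      _ < x ^ δ := Real.rpow_lt_rpow_of_exponent_lt hx1 hδ
      _ ≤ A := hA
  have hfloor : ⌊x / A⌋₊ = 0 := by
    rw [Nat.floor_eq_zero, div_lt_one (by linarith)]
    exact hxA
  unfold moment
  rw [hfloor, momentN_zero_cols]
  have hlog : 0 < Real.log x := Real.log_pos hx1
  positivity

/-- `δ ≤ 1/12` is load-bearing (this is the gen-1 refutation, re-derived from the band theorem). -/
theorem not_tableChowlaWithoutDeltaLe : ¬ TableChowlaWithoutDeltaLe := fun h =>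
  not_tableChowlaAt_of_mem_band lam_sq' (δ := 1) (by norm_num) le_rfl
    fun c hc C hC => h c hc 1 one_pos C hC

/-- The crux with `0 < C` dropped (all real `C`). -/
def TableChowlaWithoutCPos : Prop :=
  ∀ c : ℤ, c ≠ 0 → ∀ δ : ℝ, 0 < δ → δ ≤ 1 / 12 → ∀ C : ℝ, ∃ x₀ : ℝ, ∀ x : ℝ, x₀ ≤ x →
    ∀ A : ℝ, x ^ δ ≤ A → A ≤ x ^ (1 / 3 + δ) → moment lam c x A ≤ x ^ 2 / Real.log x ^ C

/-- `0 < C` is NOT load-bearing: the cases `C ≤ 0` follow from `C = 1` beyond `x ≥ e`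
(`x²/log x ≤ x² ≤ x²/(log x)^C`). Provers may ignore the sign of `C`. -/
theorem tableChowlaWithoutCPos_of (h : LiouvilleShiftedTables.TableChowla) :
    TableChowlaWithoutCPos := by
  have h' := tableChowla_iff.mp h
  intro c hc δ hδ hδ' C
  rcases lt_or_ge 0 C with hC | hC
  · exact h' c hc δ hδ hδ' C hC
  obtain ⟨x₀, hx₀⟩ := h' c hc δ hδ hδ' 1 one_pos
  refine ⟨max x₀ (Real.exp 1), fun x hx A hA hA' => ?_⟩
  have hx₀x : x₀ ≤ x := le_trans (le_max_left _ _) hx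
  have hxe : Real.exp 1 ≤ x := le_trans (le_max_right _ _) hx
  have hxpos : 0 < x := (Real.exp_pos 1).trans_le hxe
  have hlog1 : 1 ≤ Real.log x := by rw [Real.le_log_iff_exp_le hxpos]; exact hxe
  have key := hx₀ x hx₀x A hA hA'
  rw [Real.rpow_one] at key
  calc moment lam c x A ≤ x ^ 2 / Real.log x := key
    _ ≤ x ^ 2 := div_le_self (by positivity) hlog1
    _ ≤ x ^ 2 / Real.log x ^ C := by
        rw [le_div_iff₀ (Real.rpow_pos_of_pos (by linarith) C)]
        exact mul_le_of_le_one_right (by positivity)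
          (Real.rpow_le_one_of_one_le_of_nonpos hlog1 hC)

end

end Summit.Parity.GeneralizedHardyLittlewood.Theorems.TableChowla.Negative
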